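import Literature.Analysis.FluidPDE.FluidComputer.ThresholdGate
import HarnessLib

/-!
# Fluid computer blueprint — the threshold gate: first bricks of the TRANSFER window

HONEST FRAMING: low prior, high value-of-information experiment on Tao's machine paradigm; NOT a
claim that NS blows up. Everything here is elementary one-sided comparison for the 5-mode circuit
`thresholdCircuit ε σ ν μ r κ` (`ThresholdGate.lean`) under forcing of sup-size `≤ δ`; nothing is
asserted about any fluid equation, and the transfer stage itself (rotor sweep + overdamped drain
delivering `≥ η₀ - θ` of the energy to the output) remains OPEN — this file proves only the
mechanism that the numerics single out as the one to prove.

## Why these lemmas (numerics kit j049182, 138/138 runs)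

After ignition the gate's transfer could a priori fail because the trigger's net rate
`ρ = νb - μa` might collapse (the clock `b` falls at rate `νc²` once the trigger is large). The
diagnostic pass over the ladder designs (abruptness 2 … 21, nominal + 11 adversaries at
`δ = 0.1σ, 0.3σ`) shows that in EVERY run the clock moves by `≤ 0.10·ρ₁/ν` during the transfer
window and the net rate never falls below its ignition value `ρ₁` (it increases: the carrier drops,
the clock stays). This file proves that mechanism as a window lemma with explicit linear budgets:

* `carrier_le_affine` — while `a, b, c, d ≥ 0` and `c ≤ Cm` on the window, the carrier obeys
  `a(t) ≤ a(0) + (μCm² + δ)t` (pump, seed coupling and rotor only LOWER `a`; only the attenuator's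
  return `μc²` and the forcing raise it);
* `clock_ge_affine` — `b(t) ≥ b(0) - (νCm² + δ)t` (as in the pre-threshold tube, no region needed);
* `rate_ge_affine` — hence `νb(t) - μa(t) ≥ (νb(0) - μa(0)) - (ν(νCm² + δ) + μ(μCm² + δ))t`:
  **the net rate persists** up to a loss LINEAR in the window length;
* `trigger_ge_affine` — while the net rate is `≥ 0` and `c ≥ 0`: `c(t) ≥ c(0) - δt` (the trigger,
  once ignited, stays ignited up to the forcing);
* `output_ge_affine` — the output never unloads by more than `δt` (`∂ₜã = κd² + g ≥ -δ`);
* `pairEnergy_ge_affine` — while `a, c, d ≥ 0`: the output-pair energy `d² + ã²` never decreases by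
  more than `4δR·t` (the rotor feeds it `2racd ≥ 0`, the drain only moves `d² → ã²` inside it):
  energy that left the upstream modes does not come back.

The one delicate a-priori input of the eventual transfer theorem — a ceiling `Cm` for the trigger
on the window with `μCm²·(window)` small — is a HYPOTHESIS here (observed `c_max/c_eq = 2.7–8.6`;
source for a proof: the clock budget `ν∫c² ≤ (clock drop) + (εR² + δ)·(window)`).
[cite: Tao2016AveragedNS, §5.5 Thm 5.3 (5.5) (third window: energy transfer); §1.3 pp. 10–11]
-/

noncomputable section

open Set Filter Topology
open scoped NNReal

namespace Literature.Analysis.FluidPDE.FluidComputer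

open Literature.Analysis.FluidPDE.Tao2016AveragedNS Literature.Analysis.ODE

variable {ε σ ν μ r κ δ τ : ℝ} {x : ℝ → Fin 5 → ℝ}

/-- A **forced window** of the threshold gate: a continuous curve on `[0, τ]` with right derivative
within `δ` of the design field on `[0, τ)` — NO region hypothesis (the transfer runs in the bare
energy ball). [folklore] -/
structure IsForcedWindow (ε σ ν μ r κ δ τ : ℝ) (x : ℝ → Fin 5 → ℝ) : Prop where
  /-- continuity on the closed window -/
  continuousOn : ContinuousOn x (Icc 0 τ)
  /-- right-differentiable with defect at most `δ` on `[0, τ)` -/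
  defect : ∀ t ∈ Ico 0 τ, ∃ V : Fin 5 → ℝ,
    HasDerivWithinAt x V (Ici t) t ∧ ‖V - thresholdCircuit ε σ ν μ r κ (x t)‖ ≤ δ

namespace IsForcedWindow

/-- A pre-threshold curve is in particular a forced window. [folklore] -/
theorem of_isPreThresholdCurve {a₀ R : ℝ} (h : IsPreThresholdCurve ε σ ν μ r κ δ a₀ R τ x) :
    IsForcedWindow ε σ ν μ r κ δ τ x := ⟨h.continuousOn, h.defect⟩

/-- Restriction to a shorter window. [folklore] -/
theorem mono (h : IsForcedWindow ε σ ν μ r κ δ τ x) {τ' : ℝ} (hτ' : τ' ≤ τ) :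
    IsForcedWindow ε σ ν μ r κ δ τ' x :=
  ⟨h.continuousOn.mono (Icc_subset_Icc_right hτ'),
    fun t ht => h.defect t ⟨ht.1, lt_of_lt_of_le ht.2 hτ'⟩⟩

/-- **Carrier ceiling on the transfer window.** While `a, b, c, d ≥ 0` and `c ≤ Cm` on `[0, τ)`:
`a(t) ≤ a(0) + (μCm² + δ)t` — the pump `-εab`, the seed coupling `-σac` and the rotor `-rcd` only
lower the carrier; only the attenuator's return `μc²` and the forcing raise it. [folklore] -/
theorem carrier_le_affine (h : IsForcedWindow ε σ ν μ r κ δ τ x) (hε : 0 ≤ ε) (hσ : 0 ≤ σ)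
    (hμ : 0 ≤ μ) (hr : 0 ≤ r) {Cm : ℝ}
    (ha : ∀ t ∈ Ico 0 τ, 0 ≤ x t 0) (hb : ∀ t ∈ Ico 0 τ, 0 ≤ x t 1)
    (hc : ∀ t ∈ Ico 0 τ, 0 ≤ x t 2 ∧ x t 2 ≤ Cm) (hd : ∀ t ∈ Ico 0 τ, 0 ≤ x t 3) :
    ∀ t ∈ Icc 0 τ, x t 0 ≤ x 0 0 + (μ * Cm ^ 2 + δ) * t := by
  choose! V hV hVδ using h.defect
  have hcn : ContinuousOn (fun s => x s 0) (Icc 0 τ) :=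
    (continuous_apply 0).comp_continuousOn h.continuousOn
  have hdv : ∀ s ∈ Ico 0 τ, HasDerivWithinAt (fun s => x s 0) (V s 0) (Ici s) s :=
    fun s hs => (hasDerivWithinAt_pi.1 (hV s hs)) 0
  have hbd : ∀ s ∈ Ico 0 τ, V s 0 ≤ μ * Cm ^ 2 + δ := by
    intro s hs
    have hg := abs_apply_le_of_norm_le (hVδ s hs) 0
    rw [Pi.sub_apply, thresholdCircuit_apply_zero] at hg
    have h1 := (abs_le.1 hg).2
    obtain ⟨hc0, hcC⟩ := hc s hs
    have hcc : x s 2 ^ 2 ≤ Cm ^ 2 := pow_le_pow_left₀ hc0 hcC 2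
    have e1 : 0 ≤ ε * x s 0 * x s 1 := by
      have := ha s hs; have := hb s hs; positivity
    have e2 : 0 ≤ σ * x s 0 * x s 2 := by
      have := ha s hs; positivity
    have e3 : 0 ≤ r * x s 3 * x s 2 := by
      have := hd s hs; positivity
    have e4 := mul_le_mul_of_nonneg_left hcc hμ
    linarith
  intro t ht
  have := sub_le_mul_of_deriv_right_le hcn hdv hbd t ht
  simp only [sub_zero] at this
  linarith

/-- **Clock floor on the window** (no region hypothesis): while `|c| ≤ Cm` on `[0, τ)`,
`b(t) ≥ b(0) - (νCm² + δ)t`. [folklore] -/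
theorem clock_ge_affine (h : IsForcedWindow ε σ ν μ r κ δ τ x) (hε : 0 ≤ ε) (hν : 0 ≤ ν)
    {Cm : ℝ} (hc : ∀ t ∈ Ico 0 τ, |x t 2| ≤ Cm) :
    ∀ t ∈ Icc 0 τ, x 0 1 - (ν * Cm ^ 2 + δ) * t ≤ x t 1 := by
  choose! V hV hVδ using h.defect
  have hcn : ContinuousOn (fun s => x s 1) (Icc 0 τ) :=
    (continuous_apply 1).comp_continuousOn h.continuousOn
  have hdv : ∀ s ∈ Ico 0 τ, HasDerivWithinAt (fun s => x s 1) (V s 1) (Ici s) s :=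
    fun s hs => (hasDerivWithinAt_pi.1 (hV s hs)) 1
  have hbd : ∀ s ∈ Ico 0 τ, -(ν * Cm ^ 2 + δ) ≤ V s 1 := by
    intro s hs
    have hg := abs_apply_le_of_norm_le (hVδ s hs) 1
    rw [Pi.sub_apply, thresholdCircuit_apply_one] at hg
    have hcC := abs_le.1 (hc s hs)
    have hc2 : x s 2 ^ 2 ≤ Cm ^ 2 := sq_le_sq' hcC.1 hcC.2
    have ha2 : 0 ≤ ε * x s 0 ^ 2 := by positivity
    have h1 := (abs_le.1 hg).1
    have h2 := mul_le_mul_of_nonneg_left hc2 hν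
    linarith
  intro t ht
  have := mul_le_sub_of_le_deriv_right hcn hdv hbd t ht
  simp only [sub_zero] at this
  linarith

/-- **Persistence of the net rate on the transfer window.** While `a, b, c, d ≥ 0` and `c ≤ Cm` on
`[0, τ)`: `νb(t) - μa(t) ≥ (νb(0) - μa(0)) - (ν(νCm² + δ) + μ(μCm² + δ))·t` — the trigger's net
amplification rate can fall below its initial (ignition) value only by a loss LINEAR in the window
length, with slope quadratic in the trigger ceiling. This is the mechanism observed in all 138 runs
of kit j049182 (the rate in fact increases there). [folklore] -/
theorem rate_ge_affine (h : IsForcedWindow ε σ ν μ r κ δ τ x) (hε : 0 ≤ ε) (hσ : 0 ≤ σ)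
    (hν : 0 ≤ ν) (hμ : 0 ≤ μ) (hr : 0 ≤ r) {Cm : ℝ}
    (ha : ∀ t ∈ Ico 0 τ, 0 ≤ x t 0) (hb : ∀ t ∈ Ico 0 τ, 0 ≤ x t 1)
    (hc : ∀ t ∈ Ico 0 τ, 0 ≤ x t 2 ∧ x t 2 ≤ Cm) (hd : ∀ t ∈ Ico 0 τ, 0 ≤ x t 3) :
    ∀ t ∈ Icc 0 τ, (ν * x 0 1 - μ * x 0 0) - (ν * (ν * Cm ^ 2 + δ) + μ * (μ * Cm ^ 2 + δ)) * t ≤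
      ν * x t 1 - μ * x t 0 := by
  intro t ht
  have hcabs : ∀ s ∈ Ico 0 τ, |x s 2| ≤ Cm := fun s hs => by
    obtain ⟨h0, h1⟩ := hc s hs; rw [abs_of_nonneg h0]; exact h1
  have hA := h.carrier_le_affine hε hσ hμ hr ha hb hc hd t ht
  have hB := h.clock_ge_affine hε hν hcabs t ht
  have h1 := mul_le_mul_of_nonneg_left hA hμ
  have h2 := mul_le_mul_of_nonneg_left hB hν
  nlinarith [h1, h2]

/-- **The trigger stays ignited.** While the net rate `νb - μa` is `≥ 0` and `c ≥ 0` on `[0, τ)`: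
`c(t) ≥ c(0) - δt` (`∂ₜc = σa² + (νb - μa)c + g_c ≥ -δ`). [folklore] -/
theorem trigger_ge_affine (h : IsForcedWindow ε σ ν μ r κ δ τ x) (hσ : 0 ≤ σ)
    (hρ : ∀ t ∈ Ico 0 τ, 0 ≤ ν * x t 1 - μ * x t 0) (hc : ∀ t ∈ Ico 0 τ, 0 ≤ x t 2) :
    ∀ t ∈ Icc 0 τ, x 0 2 - δ * t ≤ x t 2 := by
  choose! V hV hVδ using h.defect
  have hcn : ContinuousOn (fun s => x s 2) (Icc 0 τ) :=
    (continuous_apply 2).comp_continuousOn h.continuousOn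
  have hdv : ∀ s ∈ Ico 0 τ, HasDerivWithinAt (fun s => x s 2) (V s 2) (Ici s) s :=
    fun s hs => (hasDerivWithinAt_pi.1 (hV s hs)) 2
  have hbd : ∀ s ∈ Ico 0 τ, -δ ≤ V s 2 := by
    intro s hs
    have hg := abs_apply_le_of_norm_le (hVδ s hs) 2
    rw [Pi.sub_apply, thresholdCircuit_apply_two] at hg
    have h1 := (abs_le.1 hg).1
    have e1 : 0 ≤ σ * x s 0 ^ 2 := by positivity
    have e2 : 0 ≤ (ν * x s 1 - μ * x s 0) * x s 2 := mul_nonneg (hρ s hs) (hc s hs)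
    nlinarith [h1, e1, e2]
  intro t ht
  have := mul_le_sub_of_le_deriv_right hcn hdv hbd t ht
  simp only [sub_zero] at this
  linarith

/-- **The output never unloads** by more than the forcing: `ã(t) ≥ ã(0) - δt` for `κ ≥ 0`
(`∂ₜã = κd² + g ≥ -δ`). [folklore] -/
theorem output_ge_affine (h : IsForcedWindow ε σ ν μ r κ δ τ x) (hκ : 0 ≤ κ) :
    ∀ t ∈ Icc 0 τ, x 0 4 - δ * t ≤ x t 4 := by
  choose! V hV hVδ using h.defect
  have hcn : ContinuousOn (fun s => x s 4) (Icc 0 τ) :=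
    (continuous_apply 4).comp_continuousOn h.continuousOn
  have hdv : ∀ s ∈ Ico 0 τ, HasDerivWithinAt (fun s => x s 4) (V s 4) (Ici s) s :=
    fun s hs => (hasDerivWithinAt_pi.1 (hV s hs)) 4
  have hbd : ∀ s ∈ Ico 0 τ, -δ ≤ V s 4 := by
    intro s hs
    have hg := abs_apply_le_of_norm_le (hVδ s hs) 4
    rw [Pi.sub_apply, thresholdCircuit_apply_four] at hg
    have h1 := (abs_le.1 hg).1
    have e1 : 0 ≤ κ * x s 3 ^ 2 := by positivity
    linarith
  intro t ht
  have := mul_le_sub_of_le_deriv_right hcn hdv hbd t ht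
  simp only [sub_zero] at this
  linarith

/-- **Energy that left upstream does not come back.** While `a, c, d ≥ 0` and every mode is
`≤ R` in absolute value on `[0, τ)`: the output-pair energy obeys
`d(t)² + ã(t)² ≥ d(0)² + ã(0)² - 4δR·t` — the rotor feeds the pair `2racd ≥ 0`, the drain only
moves `d² → ã²` inside it, and the forcing costs at most `2δ(|d| + |ã|) ≤ 4δR`. [folklore] -/
theorem pairEnergy_ge_affine (h : IsForcedWindow ε σ ν μ r κ δ τ x) (hr : 0 ≤ r)
    {R : ℝ} (hR : ∀ t ∈ Ico 0 τ, ∀ i, |x t i| ≤ R)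
    (ha : ∀ t ∈ Ico 0 τ, 0 ≤ x t 0) (hc : ∀ t ∈ Ico 0 τ, 0 ≤ x t 2)
    (hd : ∀ t ∈ Ico 0 τ, 0 ≤ x t 3) :
    ∀ t ∈ Icc 0 τ, (x 0 3 ^ 2 + x 0 4 ^ 2) - 4 * (δ * R) * t ≤ x t 3 ^ 2 + x t 4 ^ 2 := by
  choose! V hV hVδ using h.defect
  set P : ℝ → ℝ := fun s => x s 3 ^ 2 + x s 4 ^ 2 with hP_def
  set P' : ℝ → ℝ := fun s => 2 * (x s 3 * V s 3) + 2 * (x s 4 * V s 4) with hP'_def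
  have hPcont : ContinuousOn P (Icc 0 τ) :=
    (((continuous_apply 3).comp_continuousOn h.continuousOn).pow 2).add
      (((continuous_apply 4).comp_continuousOn h.continuousOn).pow 2)
  have hP' : ∀ s ∈ Ico 0 τ, HasDerivWithinAt P (P' s) (Ici s) s := by
    intro s hs
    have h3 := ((hasDerivWithinAt_pi.1 (hV s hs)) 3).fun_pow 2
    have h4 := ((hasDerivWithinAt_pi.1 (hV s hs)) 4).fun_pow 2
    refine (h3.add h4).congr_deriv ?_
    simp only [hP'_def, show (2 : ℕ) - 1 = 1 from rfl, pow_one, Nat.cast_ofNat]; ring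
  have hbd : ∀ s ∈ Ico 0 τ, -(4 * (δ * R)) ≤ P' s := by
    intro s hs
    have hg3 := abs_apply_le_of_norm_le (hVδ s hs) 3
    have hg4 := abs_apply_le_of_norm_le (hVδ s hs) 4
    rw [Pi.sub_apply, thresholdCircuit_apply_three] at hg3
    rw [Pi.sub_apply, thresholdCircuit_apply_four] at hg4
    have hd3 := hR s hs 3
    have hd4 := hR s hs 4
    have e1 : P' s = 2 * (x s 3 * (V s 3 - (r * x s 0 * x s 2 - κ * x s 3 * x s 4))) +
        2 * (x s 4 * (V s 4 - κ * x s 3 ^ 2)) + 2 * (r * (x s 0 * x s 2 * x s 3)) := by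
      simp only [hP'_def]; ring
    have f1 : |x s 3 * (V s 3 - (r * x s 0 * x s 2 - κ * x s 3 * x s 4))| ≤ R * δ := by
      rw [abs_mul]; exact mul_le_mul hd3 hg3 (abs_nonneg _) ((abs_nonneg _).trans hd3)
    have f2 : |x s 4 * (V s 4 - κ * x s 3 ^ 2)| ≤ R * δ := by
      rw [abs_mul]; exact mul_le_mul hd4 hg4 (abs_nonneg _) ((abs_nonneg _).trans hd4)
    have f3 : 0 ≤ r * (x s 0 * x s 2 * x s 3) := by
      have := ha s hs; have := hc s hs; have := hd s hs; positivity
    have g1 := (abs_le.1 f1).1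
    have g2 := (abs_le.1 f2).1
    rw [e1]; linarith
  intro t ht
  have := mul_le_sub_of_le_deriv_right hPcont hP' hbd t ht
  simp only [hP_def, sub_zero] at this
  linarith

/-- **The rate stays positive on a short enough window.** If the initial net rate is `ρ₁` and the
window satisfies `(ν(νCm² + δ) + μ(μCm² + δ))·τ ≤ ρ₁/2`, then (under the sign and ceiling hypotheses)
`νb - μa ≥ ρ₁/2` on `[0, τ]`, and consequently the trigger obeys `c(t) ≥ c(0) - δt`. [folklore] -/
theorem rate_ge_half (h : IsForcedWindow ε σ ν μ r κ δ τ x) (hε : 0 ≤ ε) (hσ : 0 ≤ σ)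
    (hν : 0 ≤ ν) (hμ : 0 ≤ μ) (hr : 0 ≤ r) {Cm ρ₁ : ℝ} (hρ₁ : ρ₁ ≤ ν * x 0 1 - μ * x 0 0)
    (hwin : (ν * (ν * Cm ^ 2 + δ) + μ * (μ * Cm ^ 2 + δ)) * τ ≤ ρ₁ / 2)
    (hK : 0 ≤ ν * (ν * Cm ^ 2 + δ) + μ * (μ * Cm ^ 2 + δ))
    (ha : ∀ t ∈ Ico 0 τ, 0 ≤ x t 0) (hb : ∀ t ∈ Ico 0 τ, 0 ≤ x t 1)
    (hc : ∀ t ∈ Ico 0 τ, 0 ≤ x t 2 ∧ x t 2 ≤ Cm) (hd : ∀ t ∈ Ico 0 τ, 0 ≤ x t 3) :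
    (∀ t ∈ Icc 0 τ, ρ₁ / 2 ≤ ν * x t 1 - μ * x t 0) ∧
      ∀ t ∈ Icc 0 τ, x 0 2 - δ * t ≤ x t 2 := by
  have hrate : ∀ t ∈ Icc 0 τ, ρ₁ / 2 ≤ ν * x t 1 - μ * x t 0 := by
    intro t ht
    have h1 := h.rate_ge_affine hε hσ hν hμ hr ha hb hc hd t ht
    have h2 : (ν * (ν * Cm ^ 2 + δ) + μ * (μ * Cm ^ 2 + δ)) * t ≤ ρ₁ / 2 :=
      (mul_le_mul_of_nonneg_left ht.2 hK).trans hwin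
    linarith
  refine ⟨hrate, h.trigger_ge_affine hσ (fun t ht => ?_) (fun t ht => (hc t ht).1)⟩
  have hρpos : 0 ≤ ρ₁ / 2 := by
    have hτ : 0 < τ := ht.1.trans_lt ht.2
    have : 0 ≤ (ν * (ν * Cm ^ 2 + δ) + μ * (μ * Cm ^ 2 + δ)) * τ := mul_nonneg hK hτ.le
    linarith
  exact hρpos.trans (hrate t (Ico_subset_Icc_self ht))

end IsForcedWindow

end Literature.Analysis.FluidPDE.FluidComputer

end
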